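import Literature.RepresentationTheory.FiniteGroups.CharacterDegrees
import Mathlib.Analysis.SpecialFunctions.Exp
import Mathlib.Analysis.SpecialFunctions.Pow.Real
import Mathlib.Analysis.Real.Pi.Bounds
import HarnessLib

/-!
# The largest irreducible character degree of `S_n`: the Vershik–Kerov two-sided bound
# `√(n!)·e^{-c₁√n(1+o(1))} ≤ D(n) ≤ √(n!)·e^{-c₂√n(1+o(1))}` (Vershik–Kerov 1985)

Topic `Literature/RepresentationTheory/FiniteGroups`; family `MatrixMultiplication` (kill link of the
symmetric-group routes `SnThresholdCensus`, `SnSubsetDichotomy`). ONE NAMED FACT (a `def` of type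
`Prop`; nothing is proved here).

Source. A. M. Vershik, S. V. Kerov, *Asymptotic of the largest and the typical dimensions of
irreducible representations of a symmetric group*, Funct. Anal. Appl. 19 (1985) 21–31
[VershikKerov1985] — PAYWALLED, not held (acquisition request acq-02567). The statement is vendored
AS QUOTED by I. Pak, G. Panova, D. Yeliussizov, *On the largest Kronecker and Littlewood–Richardson
coefficients*, J. Combin. Theory Ser. A 165 (2019), arXiv:1804.04693 (held, read on the page), §2.3
"Largest dimension", display (2.3)–(2.4):
"Vershik and Kerov [VK2] proved that for all `n` large enough:
`√(n!)·e^{-c₁√n(1+o(1))} ≤ D(n) ≤ √(n!)·e^{-c₂√n(1+o(1))}`, where `c₁ = π√(1/6) ≈ 1.2825` and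
`c₂ = (π−2)/π² ≈ 0.1157`", with `D(n) := max_{λ ⊢ n} f^λ` (ibid. §1.1) the largest dimension of an
irreducible complex representation of `S_n` ("Note that the lower bound follows from the Burnside
identity … However, the upper bound is rather remarkable", ibid.).

## Lean rendering

* `D(n)` is the tree's `maxCharDegree (Equiv.Perm (Fin n))` (`CharacterDegrees.lean`: the supremum
  of the degrees of the irreducible complex representations; for `S_n` these are the `f^λ`).
* "`e^{-c√n(1+o(1))}` for all `n` large enough" is rendered by its `ε`-form: for every `ε > 0`
  there is `n₀` such that for all `n ≥ n₀`,
  `√(n!)·exp(-(c₁+ε)√n) ≤ D(n) ≤ √(n!)·exp(-(c₂-ε)√n)` (equivalent to the `(1+o(1))`-in-the-exponent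
  form since `c₁, c₂ > 0`).
* Constants `vkLowerConst = π/√6` (`= π√(1/6)`), `vkUpperConst = (π-2)/π²`.

Grounds `Summit.MatrixMultiplication.MatrixMultiplication.Theses.SnSubsetDichotomy.VershikKerovBound`
(stmt-MatrixMultiplication-5540, shared with route SnThresholdCensus): item = upper half of the fact
at `ε := c₂/2`, `c := c₂/2 > 0` (since `π > 2`).

Deliberately NOT here: the Logan–Shepp / Vershik–Kerov limit shape, Plancherel-typical dimensions
(the "typical" half of the paper), Bufetov's a.s. refinement, the Kerov–Pass conjecture.
-/

noncomputable section

namespace Literature.RepresentationTheory.FiniteGroups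

/-- `c₁ = π√(1/6) = π/√6 ≈ 1.2825`, the constant in the Vershik–Kerov LOWER bound
(Pak–Panova–Yeliussizov 2019, (2.4)). [cite: VershikKerov1985, Thm. 1 (constants as quoted in Pak–Panova–Yeliussizov 2019, arXiv:1804.04693, §2.3 eq. (2.4))] -/
def vkLowerConst : ℝ := Real.pi / Real.sqrt 6

/-- `c₂ = (π − 2)/π² ≈ 0.1157`, the constant in the Vershik–Kerov UPPER bound
(Pak–Panova–Yeliussizov 2019, (2.4)). [cite: VershikKerov1985, Thm. 1 (constants as quoted in Pak–Panova–Yeliussizov 2019, arXiv:1804.04693, §2.3 eq. (2.4))] -/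
def vkUpperConst : ℝ := (Real.pi - 2) / Real.pi ^ 2

/-- **Vershik–Kerov 1985 (largest dimension of an irreducible representation of `S_n`).**
As quoted in Pak–Panova–Yeliussizov 2019, §2.3 (2.3): "for all `n` large enough:
`√(n!)·e^{-c₁√n(1+o(1))} ≤ D(n) ≤ √(n!)·e^{-c₂√n(1+o(1))}`, `c₁ = π√(1/6)`, `c₂ = (π−2)/π²`",
`D(n) = max_{λ ⊢ n} f^λ = maxCharDegree (S_n)`; `ε`-form of the `(1+o(1))` in the exponents.
Primary source paywalled at vendoring time (acq-02567); reground against Funct. Anal. Appl. 19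
(1985) 21–31 when held. [cite: VershikKerov1985, Thm. 1 (as quoted in Pak–Panova–Yeliussizov 2019, arXiv:1804.04693, §2.3 eq. (2.3))] -/
def VershikKerov1985_maxCharDegree : Prop :=
  ∀ ε : ℝ, 0 < ε → ∃ n₀ : ℕ, ∀ n : ℕ, n₀ ≤ n →
    Real.sqrt (n.factorial : ℝ) * Real.exp (-((vkLowerConst + ε) * Real.sqrt (n : ℝ))) ≤
        (maxCharDegree (Equiv.Perm (Fin n)) : ℝ) ∧
      (maxCharDegree (Equiv.Perm (Fin n)) : ℝ) ≤
        Real.sqrt (n.factorial : ℝ) * Real.exp (-((vkUpperConst - ε) * Real.sqrt (n : ℝ)))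

/-- `c₂ = (π−2)/π² > 0` since `π > 3 > 2`. [folklore] -/
theorem vkUpperConst_pos : 0 < vkUpperConst := by
  unfold vkUpperConst
  have hπ : (3 : ℝ) < Real.pi := Real.pi_gt_three
  exact div_pos (by linarith) (by positivity)

end Literature.RepresentationTheory.FiniteGroups
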